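import Mathlib
import HarnessLib
import Summits.HubbardSuperconductivity.HubbardSuperconductivity.Theorems.KLProgrammeKLRegimeTwoVolumeSourceReadout

/-!
# Route `KLProgramme` — crux K3, VL child `KLRegimeVolumeLimitV17F2` (stmt-HubbardSuperconductivity-20440), skeleton «cauchy» v9 (831d58cbda4d66f6,
# k3c4-p1 g11): THE REGISTERED TEXT OF `stub_vl_nestedFramed` (v9 form: token #24's statement ⟹ v8-F2 text) FROM THE NEAR PINNED DEFECT ALONE
# (cell gate-hubbard-kl, seat hubbard-kl-k3c5-p3 g11, technique «OS-positivity-free direct assembly»)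

Skeleton v9 registers two stubs: the producer stub `stub_vl_srcProfiles` (token #24, history-free: `∀ P R, P.WF → R.WF2 → ∃ Q′ … ∃ A L₁ M₁, ∀ L ≥ L₁, M ≥ M₁ L,
∀ j ≤ n⋆, SourceProfilesAt L M (klSrcBudget P Q′ U A j) β U μ (klFlowFrameU L M β U μ n⋆) j`) and `stub_vl_nestedFramed` := (that statement) → v8-F2's text.
This file proves the latter FROM ONE HYPOTHESIS — the NEAR pinned same-offset two-volume defect of the source-pair kernels of `srcTrunc 3 (klSrcAction_V[K_V] n⋆)`
(own flow frames) tending to zero — by composing `framedNestedFlowTextV17F2_of_srcActionNearDefect_srcPinnedSum` (door (h), `…TwoVolumeSourceReadout`) with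
token #24 read at `(P, R₁)` for the fixed well-formed package `R₁ = ⟨1, 1, 1⟩` (the producer statement's conclusion does not mention `R`; its thresholds are
met by `min`), at `j = n⋆`, `s = m = 2` (`klSrcPinnedSum_two_two_le_of_sourceProfilesAt`: budget `A n⋆ 2`, `L`-free since `A` is chosen before `L, M`).

* **`stub_vl_nestedFramed_of_nearDefect`** — conclusion = the REGISTERED TYPE of `stub_vl_nestedFramed` in v9, byte for byte; hypothesis = the NEAR text:
  inside the VL regime binders and under the tower, `∃ L₀ δ→0: ∀ L ≥ L₀, ∀ L″ = b·L, eventually in M, ∃ pins o_c, o_f with a common time,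
  2ε·Σ_{t₁,ȳ}‖K_L(o_c;(t₁,o⃗_c+ȳ)) − K_{L″}(o_f;(t₁,o⃗_f+ȳ↑))‖ ≤ δ L`.
So the k3c4-p1 lineage's (vi) composite closes `stub_vl_nestedFramed` BY NAME as `stub_vl_nestedFramed_of_nearDefect ⟨composite⟩`; what it owes is the NEAR
defect and nothing else.  Proofs only; no definition; nothing asserts superconductivity.  References: BGM 2006 §2.9 (4.3)–(4.6), §2.4 (2.38).
-/

noncomputable section

namespace Summit.HubbardSuperconductivity.HubbardSuperconductivity.Theorems.TwoPointAssembly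

set_option linter.dupNamespace false -- summit = problem name (single-conjunct summit), D-0017

open Finset Filter Topology Complex Literature.MathematicalPhysics.QuantumLattice Literature.Probability.LatticeModels GrassmannAlgebra
open Summit.HubbardSuperconductivity.HubbardSuperconductivity.Theorems.KLRegimeSplit
open Summit.HubbardSuperconductivity.HubbardSuperconductivity.Theorems.KLProgrammeLegKernels
open Summit.HubbardSuperconductivity.HubbardSuperconductivity.Theorems.EngineV8
open Summit.HubbardSuperconductivity.HubbardSuperconductivity.Theorems.TwoVolumeDefect
open Summit.HubbardSuperconductivity.HubbardSuperconductivity.Theorems.TwoVolumeSource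

/-- **THE v9 STUB `stub_vl_nestedFramed` FROM THE NEAR PINNED DEFECT ALONE** (see the module docstring).  The conclusion is the registered type of
`…KLRegimeVolumeLimitV17F2.stub_vl_nestedFramed` in skeleton «cauchy» v9 (831d58cbda4d66f6). [cite: BenfattoGiulianiMastropietro2006, §2.9 (4.3)-(4.6)] -/
theorem stub_vl_nestedFramed_of_nearDefect
    (hNear : ∀ (G : GeoConsts) (P : SplitConsts) (Q : EngConsts) (R : RenConsts), G.WF → P.WF → Q.WF → R.WF →
      ∃ c₅ : ℝ, 0 < c₅ ∧ ∀ c : ℝ, 0 < c → c ≤ c₅ → ∃ U₀ : ℝ, 0 < U₀ ∧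
        ∀ μ ∈ klWindowC, ∀ U : ℝ, 0 < U → U ≤ U₀ → ∀ β : ℝ, klBetaMin ≤ β → β ≤ Real.exp (c / U ^ 2) →
          ∀ K : TrigPolyC4v, klPredsV17F2.frameOK R U (nScales β) μ K →
            ∀ (Lstar : ℕ) (Mstar : ℕ → ℕ), TowerP klPredsV17F2 G P Q R β U μ K Lstar Mstar →
              ∃ L₀ : ℕ, ∃ δ : ℕ → ℝ, Tendsto δ atTop (𝓝 0) ∧
                ∀ (L : ℕ) [NeZero L], L₀ ≤ L → ∀ (L'' : ℕ) [NeZero L''] (b : ℕ), L'' = b * L → ∃ M₀ : ℕ, ∀ (M : ℕ) [NeZero M], M₀ ≤ M →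
                  ∃ (oc : SpaceTimeIdx L M) (of : SpaceTimeIdx L'' M), of.1 = oc.1 ∧
                    2 * imagTimeWeight β M *
                      (∑ t₁ : ImagTimeIdx M, ∑ ybar : TorusSite 2 L,
                          ‖kernel ℂ (srcTrunc ℂ (fun Y : SrcLabel L M (nScales β + 1) => Y.2 = 1) 3
                                (klSrcAction L M β U μ (klFlowFrameU L M β U μ (nScales β + 1)) (nScales β + 1))) 2
                                ![((oc, ((⟨0, sectorCount_pos _⟩, 0), 0)), 1), (((t₁, oc.2 + ybar), ((⟨0, sectorCount_pos _⟩, 0), 1)), 1)] -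
                            kernel ℂ (srcTrunc ℂ (fun Y : SrcLabel L'' M (nScales β + 1) => Y.2 = 1) 3
                                (klSrcAction L'' M β U μ (klFlowFrameU L'' M β U μ (nScales β + 1)) (nScales β + 1))) 2
                                ![((of, ((⟨0, sectorCount_pos _⟩, 0), 0)), 1),
                                  (((t₁, of.2 + Torus.proj L'' (Torus.cRep ybar)), ((⟨0, sectorCount_pos _⟩, 0), 1)), 1)]‖) ≤ δ L) :
    (∀ (P : SplitConsts) (R : RenConsts), P.WF → R.WF2 →
      ∃ Q' : EngConsts, 0 ≤ Q'.CE ∧ ∃ c₀ : ℝ, 0 < c₀ ∧ ∀ c : ℝ, 0 < c → c ≤ c₀ → ∃ U₀ : ℝ, 0 < U₀ ∧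
        ∀ μ ∈ klWindowC, ∀ U : ℝ, 0 < U → U ≤ U₀ → ∀ β : ℝ, klBetaMin ≤ β → β ≤ Real.exp (c / U ^ 2) →
          ∃ A : ℕ → ℕ → ℝ, ∃ L₁ : ℕ, ∃ M₁ : ℕ → ℕ, ∀ (L M : ℕ) [NeZero L] [NeZero M], L₁ ≤ L → M₁ L ≤ M →
            ∀ j : ℕ, j ≤ nScales β + 1 →
              SourceProfilesAt L M (klSrcBudget P Q' U A j) β U μ (klFlowFrameU L M β U μ (nScales β + 1)) j) →
    ∀ (G : GeoConsts) (P : SplitConsts) (Q : EngConsts) (R : RenConsts), G.WF → P.WF → Q.WF → R.WF →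
      ∃ c₅ : ℝ, 0 < c₅ ∧ ∀ c : ℝ, 0 < c → c ≤ c₅ → ∃ U₀ : ℝ, 0 < U₀ ∧
        ∀ μ ∈ klWindowC, ∀ U : ℝ, 0 < U → U ≤ U₀ → ∀ β : ℝ, klBetaMin ≤ β → β ≤ Real.exp (c / U ^ 2) →
          ∀ K : TrigPolyC4v, klPredsV17F2.frameOK R U (nScales β) μ K →
            ∀ (Lstar : ℕ) (Mstar : ℕ → ℕ), TowerP klPredsV17F2 G P Q R β U μ K Lstar Mstar →
              ∀ n : ℤ, ∃ L₀ : ℕ, ∃ ρ : ℕ → ℝ, Tendsto ρ atTop (𝓝 0) ∧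
                ∀ (L : ℕ) [NeZero L], L₀ ≤ L → ∀ (L'' : ℕ) [NeZero L''], L ∣ L'' → ∃ M₀ : ℕ, ∀ (M : ℕ) [NeZero M], M₀ ≤ M →
                  ∀ (ω : MatsubaraIdx M), matsubaraInt M ω = n → ∀ (k : TorusSite 2 L) (k'' : TorusSite 2 L''),
                    latticeMomentum L'' k'' = latticeMomentum L k →
                      ‖klSelfEnergy L M β U μ (klFlowFrameU L M β U μ (nScales β + 1)) klE0 (nScales β + 1) (ω, k) 0 -
                          klSelfEnergy L'' M β U μ (klFlowFrameU L'' M β U μ (nScales β + 1)) klE0 (nScales β + 1) (ω, k'') 0‖ ≤ ρ L := by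
  intro hSrc G P Q R hG hP hQ hR
  -- the NEAR text and token #24 (at `(P, R₁)`, `R₁ = ⟨1, 1, 1⟩` well-formed) share the regime thresholds by `min`
  have hR₁ : (⟨1, 1, fun _ => 1⟩ : RenConsts).WF2 := ⟨⟨zero_le_one, zero_le_one, fun _ => zero_le_one⟩, one_pos, one_pos⟩
  refine framedNestedFlowTextV17F2_of_srcActionNearDefect_srcPinnedSum ?_ G P Q R hG hP hQ hR
  intro G P Q R hG hP hQ hR
  obtain ⟨Q'', -, c₀', hc₀', hS'⟩ := hSrc P ⟨1, 1, fun _ => 1⟩ hP hR₁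
  obtain ⟨c₅, hc₅, hN⟩ := hNear G P Q R hG hP hQ hR
  refine ⟨min c₅ c₀', lt_min hc₅ hc₀', fun c hc0 hcc => ?_⟩
  obtain ⟨U₁, hU₁, hN1⟩ := hN c hc0 (hcc.trans (min_le_left _ _))
  obtain ⟨U₂, hU₂, hS2⟩ := hS' c hc0 (hcc.trans (min_le_right _ _))
  refine ⟨min U₁ U₂, lt_min hU₁ hU₂, fun μ hμ U hU0 hUU β hβmin hβmax K hK Lstar Mstar hT => ?_⟩
  obtain ⟨L₀, δ, hδ, hLn⟩ := hN1 μ hμ U hU0 (hUU.trans (min_le_left _ _)) β hβmin hβmax K hK Lstar Mstar hT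
  obtain ⟨A, L₁, M₁, hA⟩ := hS2 μ hμ U hU0 (hUU.trans (min_le_right _ _)) β hβmin hβmax
  refine ⟨max L₀ L₁, δ, A (nScales β + 1) 2, hδ, fun L _ hL L'' _ b hb => ?_⟩
  obtain ⟨M₀, hM₀⟩ := hLn L ((le_max_left _ _).trans hL) L'' b hb
  have hLL'' : L ≤ L'' := Nat.le_of_dvd (Nat.pos_of_ne_zero (NeZero.ne L'')) ⟨b, by rw [hb, mul_comm]⟩
  have hL₁ : L₁ ≤ L'' := (le_max_right _ _).trans (hL.trans hLL'')
  refine ⟨max M₀ (M₁ L''), fun M _ hM => ?_⟩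
  obtain ⟨oc, of, ht, hnear⟩ := hM₀ M ((le_max_left _ _).trans hM)
  exact ⟨oc, of, ht, hnear, klSrcPinnedSum_two_two_le_of_sourceProfilesAt
    (hA L'' M hL₁ ((le_max_right _ _).trans hM) (nScales β + 1) le_rfl) 0 _⟩

end Summit.HubbardSuperconductivity.HubbardSuperconductivity.Theorems.TwoPointAssembly

end
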